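import Literature.IUT.HodgeTheaters.PadicFrobenioidTMPairAdapter
import Literature.AlgebraicGeometry.Frobenioids.PadicKummerRelCosetGaloisFields
import Literature.AnabelianGeometry.AbsoluteAnabelian.MonoAnalyticNonarchModel
import HarnessLib

/-!
# The `TM`-pair `(Π ↷ 𝒪^⊳_{ℚ̄_p})` of an OPEN `φ₁ : Π → G_{ℚ_p}` IS an MLF-Galois `TM`-pair over the fixed field `K = ℚ̄_p^{φ₁(Π)}` —
# the `.TM` binder of `PadicFrobenioidTMPairAdapter` DISCHARGED for every `p`-adic Frobenioid base of abc-iut-L1's genuine §2 shape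
# (cell abc-iut, L5 hub node IUTchI:Cor5.3(ii), SUBDAG-IUTchI-Cor53 v1.1 residual «C53ii/N3c TM-INSTANCE-OVER-FIXED-FIELD»; small defs + proofs)

S. Mochizuki, *Inter-universal Teichmüller theory I*, kurims manuscript (May 2020), proof of Corollary 5.3 (ii), p. 144 l. 36–39 («it follows from
[AbsTopIII], Proposition 3.2, (iv) …») ([IUTchI] Cor 5.3 (ii) p.144) [claim: Mochizuki2012, status: disputed] (claim key; this file is an ADAPTER between
two of OUR interfaces, nothing of the series is asserted, no side is taken on [IUTchIII] Cor. 3.12); S. Mochizuki, *The geometry of Frobenioids II*,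
Def 2.2 p. 17 («`K`, the finite extension of `ℚ_p` determined by the open subgroup `G ⊆ Q`»), Thm 2.4 (ii) p. 20 («`K̄ᵢ` … the algebraic closure of `Kᵢ`
used to define the Galois group `Qᵢ` [so `Gᵢ = Gal(K̄ᵢ/Kᵢ)`]») [cite: MochizukiFrdII2008, Def 2.2 p.17]; S. Mochizuki, *Topics in absolute anabelian
geometry III*, Def 3.1 (i)(ii) pp. 66–67 («Let `k` be an MLF, `k̄` an algebraic closure of `k` … `Π_k` … equipped with a continuous surjection
`ε_k : Π_k ↠ G_k`»; «isomorphic to a model `T`-pair») [cite: MochizukiAbsTopIII2015, Definition 3.1 (ii) p.67].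

## What this file does (sequel to `PadicFrobenioidTMPairAdapter`, abc-iut-w4-d077; residual «N3c» of L5-t4's CENSUS Cor5.3 v1.1)

`PadicFrobenioidTMPairAdapter` packages the Frobenioid-side pair `(Π ↷ 𝒪^⊳_{ℚ̄_p})` of a continuous `φ₁ : Π →* G_{ℚ_p}` as abc-iut-L4-t2's
`GaloisMonoidPair` (`tmPairOfGaloisHom`) and makes [AbsTopIII] Prop 3.2 (iv) (`pairIsoDeterminedByGalois_holds`) consumable MODULO the displayed binder
`IsMLFGaloisMonoidPair .TM`, discharged there only for `φ₁` SURJECTIVE (base field `ℚ_p`).  HERE the binder is discharged for EVERY base of abc-iut-L1's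
genuine §2 shape — `φ₁` an OPEN HOMOMORPHISM (`IsOpenHom`; image `G = φ₁(Π)` open in `G_{ℚ_p}`) — over the fixed field `K := ℚ̄_p^G` that abc-iut-L1
already built (`PadicFrd.RelGal.baseFld`, `fixingSubgroup_baseFld`, `finiteDimensional_baseFld`, `exists_map_eq_restrictScalars`, `isAlgClosure_baseFld`,
file `PadicKummerRelCosetGaloisFields`):

* §1 `closureOfRelGal φ₁ hφ₁ : MLFClosure.{0}` — `k := K = ℚ̄_p^{φ₁(Π)}` with the restricted `p`-adic valuative structure (abc-iut-L3-t11's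
  `PadicAlgCl.subfieldValuativeRel`), a non-archimedean local field by abc-iut-L6-d2's `PadicAlgCl.isNonarchimedeanLocalField_subfield` (finite over
  `ℚ_p`), `k̄ := ℚ̄_p` (`isAlgClosure_baseFld`);
* §2 `modelDataOfRelGal φ₁ hφ₁ : ModelMLFGaloisData K ℚ̄_p` — abc-iut-L4-t2's model data «`Π_k`, `ε_k : Π_k ↠ G_k`» with `Π_k := Π` and
  `ε_K(g) := φ₁(g)` READ AS A `K`-AUTOMORPHISM of `ℚ̄_p` (`augK`; it fixes `K` pointwise by `mem_baseFld_iff`); CONTINUITY for the Krull topology over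
  `K` PROVED (a basic neighbourhood `Gal(ℚ̄_p/E)`, `E/K` finite, pulls back to `φ₁⁻¹(Gal(ℚ̄_p/E))`, open since `E/ℚ_p` is finite); SURJECTIVITY PROVED
  (`Gal(ℚ̄_p/K) = φ₁(Π)`, abc-iut-L1's `exists_map_eq_restrictScalars`);
* §3 `nonzeroIntegers_baseFld_eq` — `𝒪^⊳` computed over `𝒪_K` EQUALS `𝒪^⊳` computed over `ℤ_p` (both are `{‖x‖ ≤ 1, x ≠ 0}`: integrality over `𝒪_K`
  ⟺ integrality over `𝒪_{ℚ_p}` by transitivity along `𝒪_{ℚ_p} → 𝒪_K` — every element of `𝒪_K` has norm `≤ 1` (`PadicAlgCl.mem_integer_subfield_iff`),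
  hence is integral over `𝒪_{ℚ_p}` (abc-iut-L3-t11's `PadicAlgCl.isIntegral_iff_norm_le_one`));
* §4 `isoModelOfRelGal` — the identity isomorphism between abc-iut-L4-t2's model `TM`-pair of `modelDataOfRelGal` and `tmPairOfGaloisHom φ₁ _`, and
  **`isMLFGaloisMonoidPair_tmPairOfGaloisHom`**: `(Π ↷ 𝒪^⊳_{ℚ̄_p})` IS an MLF-Galois `TM`-pair for every open `φ₁` — so
  **`tmPairIso_isoM_eq_of_isoPi_eq_of_isOpenHom`**: [AbsTopIII] Prop 3.2 (iv) holds for the `TM`-pairs of ANY two genuine §2 bases with NO binder left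
  (the remaining displayed inputs of the adapter are the pair data `hequiv` and the two-sided integrality `hint`, residual «N3b»).

Nothing of L1/L4 is restated; no `Prop` fact is minted; no instance is declared globally (local `letI`/`haveI` only); typed ≠ proved; binder ≠ fact.
-/

noncomputable section

namespace Literature.IUT.HodgeTheaters

open Literature.AlgebraicGeometry.Frobenioids Literature.AlgebraicGeometry.Frobenioids.QuasiTemperoid
open Literature.AnabelianGeometry.AbsoluteAnabelian
open scoped ValuativeRel Topology

namespace PadicTMPair

section FixedField

variable {p : ℕ} [Fact p.Prime] {G : Type} [Group G] [TopologicalSpace G]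
  (φ₁ : G →* GalFbar ℚ_[p]) (hφ₁ : IsOpenHom φ₁)

/-! ### §1. The base field `K = ℚ̄_p^{φ₁(Π)}` as MLF closure data -/

/-- **The base field `K = ℚ̄_p^{φ₁(Π)}` with `k̄ := ℚ̄_p` as abc-iut-L4-t2's `MLFClosure` datum** («Let `k` be an MLF, `k̄` an algebraic closure of `k`»):
`k := PadicFrd.RelGal.baseFld p φ₁ hφ₁` (abc-iut-L1; finite over `ℚ_p`), valuative structure the restricted `p`-adic one (`PadicAlgCl.subfieldValuativeRel`),
local field by abc-iut-L6-d2's `PadicAlgCl.isNonarchimedeanLocalField_subfield`, `K := ℚ̄_p` an algebraic closure of `k` (`isAlgClosure_baseFld`).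
[cite: MochizukiAbsTopIII2015, Definition 3.1 (i) p.66] -/
def closureOfRelGal : MLFClosure.{0} :=
  letI := PadicAlgCl.subfieldValuativeRel (PadicFrd.RelGal.baseFld p φ₁ hφ₁)
  haveI := PadicFrd.RelGal.finiteDimensional_baseFld p φ₁ hφ₁
  haveI : IsNonarchimedeanLocalField (PadicFrd.RelGal.baseFld p φ₁ hφ₁) :=
    PadicAlgCl.isNonarchimedeanLocalField_subfield (PadicFrd.RelGal.baseFld p φ₁ hφ₁)
  haveI : CharZero (PadicFrd.RelGal.baseFld p φ₁ hφ₁) :=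
    charZero_of_injective_algebraMap (algebraMap ℚ_[p] (PadicFrd.RelGal.baseFld p φ₁ hφ₁)).injective
  haveI := PadicFrd.RelGal.isAlgClosure_baseFld p φ₁ hφ₁
  { k := PadicFrd.RelGal.baseFld p φ₁ hφ₁, K := Fbar ℚ_[p] }

/-- Its MLF is `K = ℚ̄_p^{φ₁(Π)}`. [cite: MochizukiFrdII2008, Def 2.2 p.17] -/
theorem closureOfRelGal_k : (closureOfRelGal φ₁ hφ₁).k = ↥(PadicFrd.RelGal.baseFld p φ₁ hφ₁) := rfl

/-- Its algebraic closure is `ℚ̄_p`. [cite: MochizukiFrdII2008, Thm 2.4 (ii) p.20] -/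
theorem closureOfRelGal_K : (closureOfRelGal φ₁ hφ₁).K = Fbar ℚ_[p] := rfl

/-! ### §2. `𝒪^⊳` over `𝒪_K` is `𝒪^⊳` over `ℤ_p` -/

/-- `𝒪_{ℚ_p} → 𝒪_K`: an element of `ℚ_p` of norm `≤ 1` lies in `𝒪_K` for the restricted `p`-adic valuative structure of `K`
(`PadicAlgCl.mem_integer_subfield_iff`, `PadicAlgCl.norm_extends`, the tree's `Padic.mem_valuationInteger_iff`). [cite: MochizukiAbsTopIII2015, Definition 3.1 (i) p.66] -/
def integerHom :
    letI := PadicAlgCl.subfieldValuativeRel (PadicFrd.RelGal.baseFld p φ₁ hφ₁)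
    𝒪[ℚ_[p]] →+* 𝒪[↥(PadicFrd.RelGal.baseFld p φ₁ hφ₁)] :=
  letI := PadicAlgCl.subfieldValuativeRel (PadicFrd.RelGal.baseFld p φ₁ hφ₁)
  ((algebraMap ℚ_[p] ↥(PadicFrd.RelGal.baseFld p φ₁ hφ₁)).comp (𝒪[ℚ_[p]]).subtype).codRestrict
    𝒪[↥(PadicFrd.RelGal.baseFld p φ₁ hφ₁)] (fun c => by
      rw [PadicAlgCl.mem_integer_subfield_iff]
      change ‖algebraMap (↥(PadicFrd.RelGal.baseFld p φ₁ hφ₁)) (Fbar ℚ_[p]) (algebraMap ℚ_[p] _ (c : ℚ_[p]))‖ ≤ 1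
      rw [← IsScalarTower.algebraMap_apply]
      exact (PadicAlgCl.norm_extends p (c : ℚ_[p])).le.trans
        ((Literature.NumberTheory.GaloisRepresentations.Padic.mem_valuationInteger_iff p (c : ℚ_[p])).mp c.2))

/-- **`𝒪^⊳_{ℚ̄_p}` over `𝒪_K` EQUALS `𝒪^⊳_{ℚ̄_p}` over `ℤ_p`**: for `x ∈ ℚ̄_p`, integrality over `𝒪_K` (restricted `p`-adic valuative structure on
`K = ℚ̄_p^{φ₁(Π)}`) is equivalent to integrality over `𝒪_{ℚ_p}` — `→` by transitivity along `𝒪_{ℚ_p} → 𝒪_K` (every element of `𝒪_K` has norm `≤ 1`,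
hence is integral over `𝒪_{ℚ_p}`: abc-iut-L3-t11's `PadicAlgCl.isIntegral_iff_norm_le_one`), `←` by `IsIntegral.tower_top`.  Hence abc-iut-L4-t2's
`nonzeroIntegers K ℚ̄_p = nonzeroIntegers ℚ_p ℚ̄_p` as submonoids of `ℚ̄_p`. [cite: MochizukiAbsTopIII2015, Definition 3.1 (i) p.66] -/
theorem nonzeroIntegers_baseFld_eq :
    (letI := PadicAlgCl.subfieldValuativeRel (PadicFrd.RelGal.baseFld p φ₁ hφ₁)
     nonzeroIntegers (↥(PadicFrd.RelGal.baseFld p φ₁ hφ₁)) (Fbar ℚ_[p])) = nonzeroIntegers ℚ_[p] (Fbar ℚ_[p]) := by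
  letI := PadicAlgCl.subfieldValuativeRel (PadicFrd.RelGal.baseFld p φ₁ hφ₁)
  -- the composite `𝒪_{ℚ_p} → 𝒪_K → ℚ̄_p` is the inclusion `𝒪_{ℚ_p} → ℚ̄_p`
  have hcomp : ∀ c : 𝒪[ℚ_[p]],
      algebraMap (𝒪[↥(PadicFrd.RelGal.baseFld p φ₁ hφ₁)]) (Fbar ℚ_[p]) (integerHom φ₁ hφ₁ c) =
        algebraMap (𝒪[ℚ_[p]]) (Fbar ℚ_[p]) c := fun c => by
    change algebraMap (↥(PadicFrd.RelGal.baseFld p φ₁ hφ₁)) (Fbar ℚ_[p]) (algebraMap ℚ_[p] _ (c : ℚ_[p])) =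
      algebraMap ℚ_[p] (Fbar ℚ_[p]) (c : ℚ_[p])
    exact (IsScalarTower.algebraMap_apply ℚ_[p] (↥(PadicFrd.RelGal.baseFld p φ₁ hφ₁)) (Fbar ℚ_[p]) (c : ℚ_[p])).symm
  have key : ∀ x : Fbar ℚ_[p],
      IsIntegral (𝒪[↥(PadicFrd.RelGal.baseFld p φ₁ hφ₁)]) x ↔ IsIntegral (𝒪[ℚ_[p]]) x := by
    intro x
    constructor
    · intro h
      letI alg : Algebra (𝒪[ℚ_[p]]) (𝒪[↥(PadicFrd.RelGal.baseFld p φ₁ hφ₁)]) := (integerHom φ₁ hφ₁).toAlgebra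
      haveI tower : IsScalarTower (𝒪[ℚ_[p]]) (𝒪[↥(PadicFrd.RelGal.baseFld p φ₁ hφ₁)]) (Fbar ℚ_[p]) :=
        IsScalarTower.of_algebraMap_eq fun c => (hcomp c).symm
      haveI hint : Algebra.IsIntegral (𝒪[ℚ_[p]]) (𝒪[↥(PadicFrd.RelGal.baseFld p φ₁ hφ₁)]) := by
        refine ⟨fun c => ?_⟩
        have hc : ‖(show PadicAlgCl p from ((c : ↥(PadicFrd.RelGal.baseFld p φ₁ hφ₁)) : Fbar ℚ_[p]))‖ ≤ 1 :=
          (PadicAlgCl.mem_integer_subfield_iff (PadicFrd.RelGal.baseFld p φ₁ hφ₁) c.1).mp c.2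
        have hc' : IsIntegral (𝒪[ℚ_[p]])
            (IsScalarTower.toAlgHom (𝒪[ℚ_[p]]) (𝒪[↥(PadicFrd.RelGal.baseFld p φ₁ hφ₁)]) (Fbar ℚ_[p]) c) :=
          PadicAlgCl.isIntegral_of_norm_le_one hc
        refine (isIntegral_algHom_iff _ ?_).mp hc'
        intro a b hab
        exact Subtype.ext ((algebraMap (↥(PadicFrd.RelGal.baseFld p φ₁ hφ₁)) (Fbar ℚ_[p])).injective hab)
      exact isIntegral_trans x h
    · rintro ⟨f, hf, hfx⟩
      refine ⟨f.map (integerHom φ₁ hφ₁), hf.map _, ?_⟩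
      have hcomp' : (algebraMap (𝒪[↥(PadicFrd.RelGal.baseFld p φ₁ hφ₁)]) (Fbar ℚ_[p])).comp (integerHom φ₁ hφ₁) =
          algebraMap (𝒪[ℚ_[p]]) (Fbar ℚ_[p]) := RingHom.ext hcomp
      rw [Polynomial.eval₂_map, hcomp']
      exact hfx
  ext x
  change x ∈ integersClosure _ (Fbar ℚ_[p]) ∧ x ≠ 0 ↔ x ∈ integersClosure ℚ_[p] (Fbar ℚ_[p]) ∧ x ≠ 0
  rw [mem_integersClosure_iff_isIntegral, mem_integersClosure_iff_isIntegral, key x]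
  exact Iff.rfl

/-! ### §3. The model data `(K, ℚ̄_p, ε_K := φ₁ : Π ↠ G_K)` -/

/-- `φ₁(g)` READ AS A `K`-AUTOMORPHISM of `ℚ̄_p`: it fixes `K = ℚ̄_p^{φ₁(Π)}` pointwise (abc-iut-L1's `mem_baseFld_iff`).
[cite: MochizukiFrdII2008, Def 2.2 p.17] -/
def augK (g : G) : Fbar ℚ_[p] ≃ₐ[PadicFrd.RelGal.baseFld p φ₁ hφ₁] Fbar ℚ_[p] :=
  AlgEquiv.ofRingEquiv (f := (φ₁ g).toRingEquiv)
    (fun a => (PadicFrd.RelGal.mem_baseFld_iff p φ₁ hφ₁ (a : Fbar ℚ_[p])).mp a.2 g)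

/-- `augK g` acts as `φ₁ g`. [cite: MochizukiFrdII2008, Def 2.2 p.17] -/
@[simp] theorem augK_apply (g : G) (x : Fbar ℚ_[p]) : augK φ₁ hφ₁ g x = φ₁ g x := rfl

/-- `augK g`, with scalars restricted back to `ℚ_p`, is `φ₁ g`. [cite: MochizukiFrdII2008, Def 2.2 p.17] -/
theorem restrictScalars_augK (g : G) : (augK φ₁ hφ₁ g).restrictScalars ℚ_[p] = φ₁ g :=
  AlgEquiv.ext fun _ => rfl

/-- `ε_K : Π → G_K = Gal(ℚ̄_p/K)`, `g ↦ φ₁(g)` as a `K`-automorphism, as a group homomorphism. [cite: MochizukiAbsTopIII2015, Definition 3.1 (i) p.66] -/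
def augKHom : G →* (Fbar ℚ_[p] ≃ₐ[PadicFrd.RelGal.baseFld p φ₁ hφ₁] Fbar ℚ_[p]) where
  toFun := augK φ₁ hφ₁
  map_one' := AlgEquiv.ext fun x => by
    change φ₁ 1 x = x
    rw [map_one]
    rfl
  map_mul' g h := AlgEquiv.ext fun x => by
    change φ₁ (g * h) x = φ₁ g (φ₁ h x)
    rw [map_mul]
    rfl

/-- `augKHom g = augK g`. [cite: MochizukiAbsTopIII2015, Definition 3.1 (i) p.66] -/
@[simp] theorem augKHom_apply (g : G) : augKHom φ₁ hφ₁ g = augK φ₁ hφ₁ g := rfl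

variable [IsTopologicalGroup G]

/-- **`ε_K` is continuous** for the Krull topology over `K`: a basic neighbourhood `Gal(ℚ̄_p/E)` of `1` (`E/K` finite, Mathlib
`krullTopology_mem_nhds_one_iff`) pulls back to `φ₁⁻¹(Gal(ℚ̄_p/E))`, and `E/ℚ_p` is finite (`K/ℚ_p` is), so `Gal(ℚ̄_p/E)` is open in `G_{ℚ_p}`
(`IntermediateField.fixingSubgroup_isOpen` for `E` restricted to `ℚ_p`) and `φ₁` is continuous. [cite: MochizukiAbsTopIII2015, Definition 3.1 (i) p.66] -/
theorem continuous_augKHom : Continuous (augKHom φ₁ hφ₁) := by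
  refine continuous_of_continuousAt_one (augKHom φ₁ hφ₁) ?_
  rw [ContinuousAt, map_one, Filter.tendsto_def]
  intro s hs
  obtain ⟨E, hE, hEs⟩ := (krullTopology_mem_nhds_one_iff _ _ s).mp hs
  haveI := hE
  haveI := PadicFrd.RelGal.finiteDimensional_baseFld p φ₁ hφ₁
  have hfin : Module.Finite ℚ_[p] (↥E) := Module.Finite.trans (↥(PadicFrd.RelGal.baseFld p φ₁ hφ₁)) (↥E)
  haveI : FiniteDimensional ℚ_[p] (E.restrictScalars ℚ_[p]) :=
    Module.Finite.equiv (R := ℚ_[p]) (M := ↥E)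
      { toFun := fun x => ⟨x.1, x.2⟩
        invFun := fun x => ⟨x.1, x.2⟩
        map_add' := fun _ _ => rfl
        map_smul' := fun _ _ => rfl
        left_inv := fun _ => rfl
        right_inv := fun _ => rfl }
  have hopen : IsOpen (φ₁ ⁻¹' ((E.restrictScalars ℚ_[p]).fixingSubgroup : Set (GalFbar ℚ_[p]))) :=
    (IntermediateField.fixingSubgroup_isOpen (E.restrictScalars ℚ_[p])).preimage (IsOpenHom.continuous hφ₁)
  refine Filter.mem_of_superset (hopen.mem_nhds ?_) ?_
  · change φ₁ 1 ∈ (E.restrictScalars ℚ_[p]).fixingSubgroup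
    rw [map_one]
    exact Subgroup.one_mem _
  · intro g hg
    change augKHom φ₁ hφ₁ g ∈ s
    apply hEs
    rw [SetLike.mem_coe, IntermediateField.mem_fixingSubgroup_iff]
    intro x hx
    exact (IntermediateField.mem_fixingSubgroup_iff _ _).mp hg x ((IntermediateField.mem_restrictScalars ℚ_[p]).mpr hx)

omit [IsTopologicalGroup G] in
/-- **`ε_K` is surjective**: `Gal(ℚ̄_p/K) = G = φ₁(Π)` (Krull's correspondence for the open subgroup `G`; abc-iut-L1's
`exists_map_eq_restrictScalars`). [cite: MochizukiFrdII2008, Def 2.2 p.17] -/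
theorem augKHom_surjective : Function.Surjective (augKHom φ₁ hφ₁) := by
  intro σ
  obtain ⟨g, hg⟩ := PadicFrd.RelGal.exists_map_eq_restrictScalars p φ₁ hφ₁ σ
  refine ⟨g, AlgEquiv.ext fun x => ?_⟩
  change φ₁ g x = σ x
  rw [hg]
  rfl

/-- **The model data `(k := K, k̄ := ℚ̄_p, Π_k := Π, ε_k := φ₁)` of [AbsTopIII] Def 3.1 (i)** for a `p`-adic Frobenioid base of abc-iut-L1's genuine §2
shape (`φ₁ : Π → G_{ℚ_p}` an open homomorphism) — «`Π_k` a topological group, equipped with a continuous surjection `ε_k : Π_k ↠ G_k`»: continuity and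
surjectivity PROVED (`continuous_augKHom`, `augKHom_surjective`). [cite: MochizukiAbsTopIII2015, Definition 3.1 (i) p.66] -/
def modelDataOfRelGal : ModelMLFGaloisData (closureOfRelGal φ₁ hφ₁).k (closureOfRelGal φ₁ hφ₁).K where
  Pi := G
  aug := augKHom φ₁ hφ₁
  continuous_aug := continuous_augKHom φ₁ hφ₁
  aug_surjective := augKHom_surjective φ₁ hφ₁

/-! ### §4. The identity isomorphism with the model `TM`-pair; the `.TM` binder DISCHARGED -/

/-- **The identity isomorphism between abc-iut-L4-t2's model `TM`-pair `(Π ↷ 𝒪^⊳)` of `modelDataOfRelGal` (monoid computed over `𝒪_K`) and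
`tmPairOfGaloisHom φ₁ _` (monoid computed over `ℤ_p`)**: same group `Π`, same carrier by `nonzeroIntegers_baseFld_eq`, same action `g ↦ φ₁(g)`.
[cite: MochizukiAbsTopIII2015, Definition 3.1 (ii) p.67] -/
def isoModelOfRelGal :
    GaloisMonoidPair.Iso (modelDataOfRelGal φ₁ hφ₁).tmPair (tmPairOfGaloisHom φ₁ (IsOpenHom.continuous hφ₁)) where
  isoPi := ContinuousMulEquiv.refl G
  isoM := MulEquiv.submonoidCongr (nonzeroIntegers_baseFld_eq φ₁ hφ₁)
  smul_comm _ _ := Subtype.ext rfl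

/-- **THE `.TM` BINDER DISCHARGED for every genuine §2 base**: for an OPEN homomorphism `φ₁ : Π → G_{ℚ_p}` the pair `(Π ↷ 𝒪^⊳_{ℚ̄_p})`
(`tmPairOfGaloisHom`) IS an MLF-Galois `TM`-pair — isomorphic (by the identity) to the model `TM`-pair of the model data `(K, ℚ̄_p, ε_K := φ₁)`,
`K = ℚ̄_p^{φ₁(Π)}`. [cite: MochizukiAbsTopIII2015, Definition 3.1 (ii) p.67] -/
theorem isMLFGaloisMonoidPair_tmPairOfGaloisHom : IsMLFGaloisMonoidPair .TM (tmPairOfGaloisHom φ₁ (IsOpenHom.continuous hφ₁)) :=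
  ⟨⟨closureOfRelGal φ₁ hφ₁, modelDataOfRelGal φ₁ hφ₁, (modelDataOfRelGal φ₁ hφ₁).tmPair,
    (modelDataOfRelGal φ₁ hφ₁).monoidPair_TM, ⟨isoModelOfRelGal φ₁ hφ₁⟩⟩⟩

/-- **[AbsTopIII] Prop 3.2 (iv) for the `TM`-pairs of ANY two genuine §2 bases, NO binder**: two isomorphisms
`(Π₁ ↷ 𝒪^⊳_{ℚ̄_{p₁}}) ⥲ (Π₂ ↷ 𝒪^⊳_{ℚ̄_{p₂}})` with the same Galois component agree on `𝒪^⊳` (abc-iut-L4-t2's `pairIsoDeterminedByGalois_holds` through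
`tmPairIso_isoM_eq_of_isoPi_eq`, the `.TM` inputs being `isMLFGaloisMonoidPair_tmPairOfGaloisHom`). [cite: MochizukiAbsTopIII2015, Proposition 3.2 (iv) p.72] -/
theorem tmPairIso_isoM_eq_of_isoPi_eq_of_isOpenHom {p₂ : ℕ} [Fact p₂.Prime] {G₂ : Type} [Group G₂] [TopologicalSpace G₂]
    [IsTopologicalGroup G₂] (φ₂ : G₂ →* GalFbar ℚ_[p₂]) (hφ₂ : IsOpenHom φ₂)
    (e₁ e₂ : GaloisMonoidPair.Iso (tmPairOfGaloisHom φ₁ (IsOpenHom.continuous hφ₁)) (tmPairOfGaloisHom φ₂ (IsOpenHom.continuous hφ₂)))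
    (h : e₁.isoPi = e₂.isoPi) : e₁.isoM = e₂.isoM :=
  tmPairIso_isoM_eq_of_isoPi_eq φ₁ (IsOpenHom.continuous hφ₁) φ₂ (IsOpenHom.continuous hφ₂) (isMLFGaloisMonoidPair_tmPairOfGaloisHom φ₁ hφ₁)
    (isMLFGaloisMonoidPair_tmPairOfGaloisHom φ₂ hφ₂) e₁ e₂ h

include hφ₁ in
/-- **The Frobenioid-side `ψ̄` of a Ψ-induced [FrdII] Thm 2.4 (ii) pair over genuine §2 bases is DETERMINED on `𝒪^⊳_{ℚ̄_{p₁}}` by its Galois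
component `φ`** — the form [IUTchI] Cor 5.3 (ii)'s clause (b) consumes, now with NO `.TM` binder (only the displayed pair data `hequiv`, `hint` of the two
pairs remain). ([IUTchI] Cor 5.3 (ii) p.144) [claim: Mochizuki2012, status: disputed] -/
theorem psibar_apply_eq_of_galois_eq_of_isOpenHom {p₂ : ℕ} [Fact p₂.Prime] {G₂ : Type} [Group G₂] [TopologicalSpace G₂]
    [IsTopologicalGroup G₂] (φ₂ : G₂ →* GalFbar ℚ_[p₂]) (hφ₂ : IsOpenHom φ₂) (φ : G ≃ₜ* G₂)
    (ψbar : (Fbar ℚ_[p])ˣ ≃* (Fbar ℚ_[p₂])ˣ)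
    (hint : ∀ u : (Fbar ℚ_[p])ˣ,
      ‖(show PadicAlgCl p from (u : Fbar ℚ_[p]))‖ ≤ 1 ↔ ‖(show PadicAlgCl p₂ from ((ψbar u : (Fbar ℚ_[p₂])ˣ) : Fbar ℚ_[p₂]))‖ ≤ 1)
    (hequiv : ∀ (g : G) (u : (Fbar ℚ_[p])ˣ),
      ψbar (Units.map ((φ₁ g : GalFbar ℚ_[p]) : Fbar ℚ_[p] →* Fbar ℚ_[p]) u) =
        Units.map ((φ₂ (φ g) : GalFbar ℚ_[p₂]) : Fbar ℚ_[p₂] →* Fbar ℚ_[p₂]) (ψbar u))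
    (ψbar' : (Fbar ℚ_[p])ˣ ≃* (Fbar ℚ_[p₂])ˣ)
    (hint' : ∀ u : (Fbar ℚ_[p])ˣ,
      ‖(show PadicAlgCl p from (u : Fbar ℚ_[p]))‖ ≤ 1 ↔ ‖(show PadicAlgCl p₂ from ((ψbar' u : (Fbar ℚ_[p₂])ˣ) : Fbar ℚ_[p₂]))‖ ≤ 1)
    (hequiv' : ∀ (g : G) (u : (Fbar ℚ_[p])ˣ),
      ψbar' (Units.map ((φ₁ g : GalFbar ℚ_[p]) : Fbar ℚ_[p] →* Fbar ℚ_[p]) u) =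
        Units.map ((φ₂ (φ g) : GalFbar ℚ_[p₂]) : Fbar ℚ_[p₂] →* Fbar ℚ_[p₂]) (ψbar' u))
    (x : ↥(nonzeroIntegers ℚ_[p] (Fbar ℚ_[p]))) :
    ψbar (ModelMLFGaloisData.toUnit x) = ψbar' (ModelMLFGaloisData.toUnit x) :=
  psibar_apply_eq_of_galois_eq φ₁ (IsOpenHom.continuous hφ₁) φ₂ (IsOpenHom.continuous hφ₂) (isMLFGaloisMonoidPair_tmPairOfGaloisHom φ₁ hφ₁)
    (isMLFGaloisMonoidPair_tmPairOfGaloisHom φ₂ hφ₂) φ ψbar hint hequiv ψbar' hint' hequiv' x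

end FixedField

end PadicTMPair

end Literature.IUT.HodgeTheaters
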